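import Summits.Ventures.HSemireg.WeilFramePureWeil

/-!
# Venture HSemireg — the EULER PIN of the pure Weil row as a kernel identity: `Σ_k (-1)^k dim S_k(c₊ + c₋) = -2`,
# `Σ_k (-1)^k dim S_k(c±) = 0` (frame, Weil datum, and the real carrier `ΛH¹(A)`)

HONEST FRAMING. Part of the Lean index of the computation cell `pub-hsemireg` (seat w3-mod4-1 gen 9, W3 SPECIAL FIBRES,
MOD4-OFFSPLIT (E4) / PLAN-W3 row T1-9a: «pure Weil Mukai vectors: NO — the pin forces `(w,w)_χ = -2 < 0` against Hodge–Riemann»).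
Finite-dimensional exterior / linear algebra plus the tree's real carriers and the Literature's Weil-type layer ONLY: no
semiregularity map, no Ext group, no Euler characteristic of any sheaf is constructed here; nothing here says that HC / HC_CM / HC_AV
holds; nothing here is a claim about any explicit variety; no Literature fact is declared; NO definition is introduced. The two
bridges that turn this identity into the exclusion (E4) — LEMMA PIN «`χ(E,E) = Σ(-1)^k R_k(v)` for a totally semiregular `E`»
[BF08 §6.4] and HRR-SPLIT «`χ = (w,w)_χ > 0` for a pure Weil vector» — are NOT formalised; only the RANK SIDE is.

WHAT IS PROVED. `alternating_sum_pureW_row`: a row `R` with `R_0 = R_{2n} = 1` and `R_k = 2·C(2n,k)` for `1 ≤ k ≤ 2n - 1` (`n ≥ 1`)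
has `Σ_{k ≤ 2n} (-1)^k R_k = -2`; `alternating_sum_choose_row`: a row with `R_k = C(2n,k)` for all `k ≤ 2n` has alternating sum `0`
(Mathlib `Int.alternating_sum_range_choose_of_ne`). Applied to FILE 16 (`WeilFramePureWeil.lean`):
**`alternating_sum_finrank_S_pureWeil_nn`** (frame: `Σ (-1)^k dim S_k(a·w₊ + b·w₋) = -2`), **`alternating_sum_finrank_S_pureWeilUp_nn`**
/ **`…Low_nn`** (`= 0`), **`alternating_sum_finrank_S_pureWeilDatum`** (Weil datum), and on the real carrier
**`alternating_sum_finrank_S_pureWeilType`** (`Σ_{k ≤ 2n} (-1)^k dim S_k(ĉ₊ + ĉ₋) = -2` for non-zero Weil classes `c± ∈ E±` of a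
polarised Weil-type abelian `2n`-fold, `n ≥ 1`) and **`alternating_sum_finrank_S_pureWeilType_plus` / `_minus`** (`= 0`).
Everything PROVED, 0 sorry.
References: [BuchweitzFlenner2008HH] Prop. 6.4.4 (why these operators; §6.4 for the pin, not formalised);
[vanGeemen1994HodgeAV] 4.9, Lemma 5.2; [BourbakiAlgebre1a3] Ch. III §11 no. 9.
-/

noncomputable section

open CliffordAlgebra (contractLeft)
open ExteriorAlgebra (ι)
open Module CategoryTheory
open Literature.AlgebraicGeometry.Motives Literature.AlgebraicGeometry.HodgeTheory
open Literature.AlgebraicTopology.SingularHomology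

namespace Summit.Ventures.HSemireg.WeilFrame

open Summit.Ventures.HSemireg.WedgeBridge Summit.Ventures.HSemireg.WeilCarrier Summit.Ventures.HSemireg.Mod4Carrier

/-! ### 1. The two alternating sums (combinatorics) -/

section Combinatorics

/-- **the pure-W row sums to `-2`:** if `R_0 = R_{2n} = 1` and `R_k = 2·C(2n,k)` for `1 ≤ k ≤ 2n - 1` (`n ≥ 1`), then
`Σ_{k ≤ 2n} (-1)^k R_k = -2` (`= 2·(1 - 1)^{2n} - 1 - 1`). -/
theorem alternating_sum_pureW_row {n : ℕ} (hn : 1 ≤ n) (R : ℕ → ℕ) (h0 : R 0 = 1) (htop : R (n + n) = 1)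
    (hmid : ∀ k, 1 ≤ k → k + 1 ≤ n + n → R k = 2 * (n + n).choose k) :
    ∑ k ∈ Finset.range (n + n + 1), (-1 : ℤ) ^ k * (R k : ℤ) = -2 := by
  have halt : ∑ k ∈ Finset.range (n + n + 1), (-1 : ℤ) ^ k * ((n + n).choose k : ℤ) = 0 :=
    Int.alternating_sum_range_choose_of_ne (by omega)
  have hev : (-1 : ℤ) ^ (n + n) = 1 := by rw [← two_mul, pow_mul, neg_one_sq, one_pow]
  have hR : ∀ k ∈ Finset.range (n + n + 1), (-1 : ℤ) ^ k * (R k : ℤ) =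
      2 * ((-1 : ℤ) ^ k * ((n + n).choose k : ℤ)) - (if k = 0 then 1 else 0) - (if k = n + n then 1 else 0) := by
    intro k hk
    rw [Finset.mem_range] at hk
    by_cases hk0 : k = 0
    · subst hk0
      have h2 : (0 : ℕ) ≠ n + n := by omega
      rw [h0, if_pos rfl, if_neg h2, pow_zero, Nat.choose_zero_right]
      norm_num
    · by_cases hkt : k = n + n
      · subst hkt
        rw [htop, if_neg hk0, if_pos rfl, hev, Nat.choose_self]
        norm_num
      · rw [hmid k (by omega) (by omega), if_neg hk0, if_neg hkt]
        push_cast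
        ring
  rw [Finset.sum_congr rfl hR, Finset.sum_sub_distrib, Finset.sum_sub_distrib, ← Finset.mul_sum, halt,
    Finset.sum_ite_eq' (Finset.range (n + n + 1)) 0, Finset.sum_ite_eq' (Finset.range (n + n + 1)) (n + n)]
  simp

/-- **the binomial row sums to `0`:** if `R_k = C(2n,k)` for all `k ≤ 2n` (`n ≥ 1`), then `Σ_{k ≤ 2n} (-1)^k R_k = 0`. -/
theorem alternating_sum_choose_row {n : ℕ} (hn : 1 ≤ n) (R : ℕ → ℕ) (hR : ∀ k, k ≤ n + n → R k = (n + n).choose k) :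
    ∑ k ∈ Finset.range (n + n + 1), (-1 : ℤ) ^ k * (R k : ℤ) = 0 := by
  have halt : ∑ k ∈ Finset.range (n + n + 1), (-1 : ℤ) ^ k * ((n + n).choose k : ℤ) = 0 :=
    Int.alternating_sum_range_choose_of_ne (by omega)
  rw [← halt]
  refine Finset.sum_congr rfl fun k hk => ?_
  rw [Finset.mem_range] at hk
  rw [hR k (by omega)]

end Combinatorics

/-! ### 2. In an adapted frame -/

section Frame

variable {K : Type*} [Field K] {V : Type*} [AddCommGroup V] [Module K V] {n : ℕ}
  (bV : Basis (Fin ((n + n) + (n + n))) K V)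

/-- **Euler pin of the pure Weil class in a frame:** `Σ_{k ≤ 2n} (-1)^k dim S_k(a·w₊ + b·w₋) = -2` (`n ≥ 1`, `a, b ≠ 0`).
[cite: BuchweitzFlenner2008HH, Prop. 6.4.4] -/
theorem alternating_sum_finrank_S_pureWeil_nn (hn : 1 ≤ n) {a b : K} (ha : a ≠ 0) (hb : b ≠ 0) :
    ∑ k ∈ Finset.range (n + n + 1),
        (-1 : ℤ) ^ k * (finrank K ↥(S K (Lsp bV) k (a • wUp bV n + b • wLow bV n)) : ℤ) = -2 :=
  alternating_sum_pureW_row hn (fun k => finrank K ↥(S K (Lsp bV) k (a • wUp bV n + b • wLow bV n)))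
    (finrank_S_pureWeil_nn_zero' bV hn b ha) (finrank_S_pureWeil_nn_top' bV hn b ha)
    (fun _ hk1 hk => finrank_S_pureWeil_nn_all bV hk1 hk ha hb)

/-- `Σ_{k ≤ 2n} (-1)^k dim S_k(a·w₊) = 0` (`n ≥ 1`, `a ≠ 0`, char `0`). [cite: BuchweitzFlenner2008HH, Prop. 6.4.4] -/
theorem alternating_sum_finrank_S_pureWeilUp_nn [CharZero K] (hn : 1 ≤ n) {a : K} (ha : a ≠ 0) :
    ∑ k ∈ Finset.range (n + n + 1), (-1 : ℤ) ^ k * (finrank K ↥(S K (Lsp bV) k (a • wUp bV n)) : ℤ) = 0 :=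
  alternating_sum_choose_row hn (fun k => finrank K ↥(S K (Lsp bV) k (a • wUp bV n)))
    (fun _ hk => finrank_S_pureWeilUp_nn_all bV hn hk ha)

/-- `Σ_{k ≤ 2n} (-1)^k dim S_k(b·w₋) = 0` (`n ≥ 1`, `b ≠ 0`, char `0`). [cite: BuchweitzFlenner2008HH, Prop. 6.4.4] -/
theorem alternating_sum_finrank_S_pureWeilLow_nn [CharZero K] (hn : 1 ≤ n) {b : K} (hb : b ≠ 0) :
    ∑ k ∈ Finset.range (n + n + 1), (-1 : ℤ) ^ k * (finrank K ↥(S K (Lsp bV) k (b • wLow bV n)) : ℤ) = 0 :=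
  alternating_sum_choose_row hn (fun k => finrank K ↥(S K (Lsp bV) k (b • wLow bV n)))
    (fun _ hk => finrank_S_pureWeilLow_nn_all bV hn hk hb)

end Frame

/-! ### 3. For a Weil datum -/

section Datum

variable {K : Type*} [Field K] {V : Type*} [AddCommGroup V] [Module K V]

/-- **Euler pin of the pure Weil class of a Weil datum:** `Σ_{k ≤ 2n} (-1)^k dim S_k(w₊ + w₋) = -2` (type `(n,n)`, `n ≥ 1`,
char `0`). [cite: BuchweitzFlenner2008HH, Prop. 6.4.4] [cite: BourbakiAlgebre1a3, Ch. III §11 no. 9] -/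
theorem alternating_sum_finrank_S_pureWeilDatum [FiniteDimensional K V] [CharZero K] {n : ℕ} {L P Q : Submodule K V}
    {Θ wP wQ : ExteriorAlgebra K V} (hV : finrank K V = (n + n) + (n + n)) (hPQ : Disjoint P Q)
    (hL : finrank K L = n + n) (hLQ : finrank K ↥(L ⊓ Q) = n) (hLP : finrank K ↥(L ⊓ P) = n)
    (hP : finrank K ↥P = n + n) (hQ : finrank K ↥Q = n + n) (hΘ : Θ ∈ Submodule.span K
      {z : ExteriorAlgebra K V | ∃ x l : V, ((x ∈ P ∧ l ∈ L ⊓ Q) ∨ (x ∈ Q ∧ l ∈ L ⊓ P)) ∧ z = ι K x * ι K l})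
    (hnd : ∀ l ∈ (L : Set V), ι K l ∈ Submodule.span K {y : ExteriorAlgebra K V |
      ∃ φ ∈ {θ : Module.Dual K V | ∀ q ∈ L, θ q = 0}, y = contractLeft φ Θ})
    (hwP : wP ∈ ((⋀[K]^(finrank K ↥P) ↥P).map (ExteriorAlgebra.map P.subtype).toLinearMap)) (hwP0 : wP ≠ 0)
    (hwQ : wQ ∈ ((⋀[K]^(finrank K ↥Q) ↥Q).map (ExteriorAlgebra.map Q.subtype).toLinearMap)) (hwQ0 : wQ ≠ 0)
    (hn : 1 ≤ n) :
    ∑ k ∈ Finset.range (n + n + 1), (-1 : ℤ) ^ k * (finrank K ↥(S K L k (wP + wQ)) : ℤ) = -2 := by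
  obtain ⟨bV, a, b, ha, hb, hLsp, -, rfl, rfl, -⟩ :=
    exists_frame_of_weilDatum hV hPQ hL hLQ hLP hP hQ hΘ hnd hwP hwP0 hwQ hwQ0
  rw [← hLsp]
  exact alternating_sum_finrank_S_pureWeil_nn bV hn ha hb

end Datum

/-! ### 4. On the real carrier `ΛH¹(A)` -/

section RealCarrier

variable {A : AbelianVariety ℂ}

/-- **EULER PIN OF THE PURE WEIL CLASS ON THE REAL CARRIER:** for `A` of dimension `2n` (`n ≥ 1`), `φ ≫ φ = -(d • 𝟙 A)`, `d ≥ 1`,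
`P, Q` the `±i√d`-eigenspaces, `dim (P ⊓ H^{1,0}) = n`, a `K`-symmetric `(1,1)`-class `h` with `ĥ^{2n} ≠ 0`, and NON-ZERO Weil
classes `c₊ ∈ E₊`, `c₋ ∈ E₋`: `Σ_{k ≤ 2n} (-1)^k dim S_k(ĉ₊ + ĉ₋) = -2` — the rank side of MOD4-OFFSPLIT (E4) («a totally
semiregular object with a pure Weil Mukai vector would have `χ(E,E) = -2`»). [cite: BuchweitzFlenner2008HH, Prop. 6.4.4]
[cite: vanGeemen1994HodgeAV, 4.9 and Lemma 5.2] -/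
theorem alternating_sum_finrank_S_pureWeilType (hA : IsSmoothProjective A.dim A.X) {n d : ℕ} (hdim : A.dim = n + n)
    (hd : 0 < d) {φ : A ⟶ A} (hφ : φ ≫ φ = -(d • 𝟙 A)) {P Q : Submodule ℂ (complexBetti A.X 1)}
    (hP : P = Module.End.eigenspace (complexBetti.map φ.hom.hom.hom 1).hom (Complex.I * (Real.sqrt d : ℂ)))
    (hQ : Q = Module.End.eigenspace (complexBetti.map φ.hom.hom.hom 1).hom (-(Complex.I * (Real.sqrt d : ℂ))))
    (hp : finrank ℂ ↥(P ⊓ hodgeOneZero hA) = n) {h : complexBetti A.X 2}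
    (hh : complexBetti.map φ.hom.hom.hom 2 h = (d : ℂ) • h) (h11 : IsOfHodgeType A.dim A.X 2 1 1 h)
    (hvol : ((⋀[ℂ]^2 (complexBetti A.X 1)).subtype ((abelianVarietyCohomologyExteriorH1_holds.equiv A 2).symm h)) ^ (n + n) ≠ 0)
    {cP : complexBetti A.X (2 * n)} (hcP : cP ∈ weilClassesPlus A φ n d) (hcP0 : cP ≠ 0)
    {cQ : complexBetti A.X (2 * n)} (hcQ : cQ ∈ weilClassesMinus A φ n d) (hcQ0 : cQ ≠ 0) (hn : 1 ≤ n) :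
    ∑ k ∈ Finset.range (n + n + 1), (-1 : ℤ) ^ k *
        (finrank ℂ ↥(S ℂ (hodgeZeroOne hA) k
          ((⋀[ℂ]^(2 * n) (complexBetti A.X 1)).subtype ((abelianVarietyCohomologyExteriorH1_holds.equiv A (2 * n)).symm cP) +
            (⋀[ℂ]^(2 * n) (complexBetti A.X 1)).subtype ((abelianVarietyCohomologyExteriorH1_holds.equiv A (2 * n)).symm cQ))) : ℤ) =
      -2 :=
  alternating_sum_pureW_row hn _ (finrank_S_pureWeilType_zero hA hdim hd hφ hP hQ hp hh h11 hvol hcP hcP0 hcQ hcQ0 hn)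
    (finrank_S_pureWeilType_top hA hdim hd hφ hP hQ hp hh h11 hvol hcP hcP0 hcQ hcQ0 hn)
    (fun _ hk1 hk => finrank_S_pureWeilType_all hA hdim hd hφ hP hQ hp hh h11 hvol hcP hcP0 hcQ hcQ0 hk1 hk)

/-- `Σ_{k ≤ 2n} (-1)^k dim S_k(ĉ₊) = 0` for a non-zero class `c₊` of the Weil line `E₊` (`n ≥ 1`).
[cite: BuchweitzFlenner2008HH, Prop. 6.4.4] [cite: vanGeemen1994HodgeAV, 4.9] -/
theorem alternating_sum_finrank_S_pureWeilType_plus (hA : IsSmoothProjective A.dim A.X) {n d : ℕ} (hdim : A.dim = n + n)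
    (hd : 0 < d) {φ : A ⟶ A} (hφ : φ ≫ φ = -(d • 𝟙 A)) {P Q : Submodule ℂ (complexBetti A.X 1)}
    (hP : P = Module.End.eigenspace (complexBetti.map φ.hom.hom.hom 1).hom (Complex.I * (Real.sqrt d : ℂ)))
    (hQ : Q = Module.End.eigenspace (complexBetti.map φ.hom.hom.hom 1).hom (-(Complex.I * (Real.sqrt d : ℂ))))
    (hp : finrank ℂ ↥(P ⊓ hodgeOneZero hA) = n) {h : complexBetti A.X 2}
    (hh : complexBetti.map φ.hom.hom.hom 2 h = (d : ℂ) • h) (h11 : IsOfHodgeType A.dim A.X 2 1 1 h)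
    (hvol : ((⋀[ℂ]^2 (complexBetti A.X 1)).subtype ((abelianVarietyCohomologyExteriorH1_holds.equiv A 2).symm h)) ^ (n + n) ≠ 0)
    {cP : complexBetti A.X (2 * n)} (hcP : cP ∈ weilClassesPlus A φ n d) (hcP0 : cP ≠ 0) (hn : 1 ≤ n) :
    ∑ k ∈ Finset.range (n + n + 1), (-1 : ℤ) ^ k *
        (finrank ℂ ↥(S ℂ (hodgeZeroOne hA) k
          ((⋀[ℂ]^(2 * n) (complexBetti A.X 1)).subtype ((abelianVarietyCohomologyExteriorH1_holds.equiv A (2 * n)).symm cP))) : ℤ) =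
      0 :=
  alternating_sum_choose_row hn _
    (fun _ hk => finrank_S_pureWeilType_plus_all hA hdim hd hφ hP hQ hp hh h11 hvol hcP hcP0 hn hk)

/-- `Σ_{k ≤ 2n} (-1)^k dim S_k(ĉ₋) = 0` for a non-zero class `c₋` of the Weil line `E₋` (`n ≥ 1`).
[cite: BuchweitzFlenner2008HH, Prop. 6.4.4] [cite: vanGeemen1994HodgeAV, 4.9] -/
theorem alternating_sum_finrank_S_pureWeilType_minus (hA : IsSmoothProjective A.dim A.X) {n d : ℕ} (hdim : A.dim = n + n)
    (hd : 0 < d) {φ : A ⟶ A} (hφ : φ ≫ φ = -(d • 𝟙 A)) {P Q : Submodule ℂ (complexBetti A.X 1)}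
    (hP : P = Module.End.eigenspace (complexBetti.map φ.hom.hom.hom 1).hom (Complex.I * (Real.sqrt d : ℂ)))
    (hQ : Q = Module.End.eigenspace (complexBetti.map φ.hom.hom.hom 1).hom (-(Complex.I * (Real.sqrt d : ℂ))))
    (hp : finrank ℂ ↥(P ⊓ hodgeOneZero hA) = n) {h : complexBetti A.X 2}
    (hh : complexBetti.map φ.hom.hom.hom 2 h = (d : ℂ) • h) (h11 : IsOfHodgeType A.dim A.X 2 1 1 h)
    (hvol : ((⋀[ℂ]^2 (complexBetti A.X 1)).subtype ((abelianVarietyCohomologyExteriorH1_holds.equiv A 2).symm h)) ^ (n + n) ≠ 0)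
    {cQ : complexBetti A.X (2 * n)} (hcQ : cQ ∈ weilClassesMinus A φ n d) (hcQ0 : cQ ≠ 0) (hn : 1 ≤ n) :
    ∑ k ∈ Finset.range (n + n + 1), (-1 : ℤ) ^ k *
        (finrank ℂ ↥(S ℂ (hodgeZeroOne hA) k
          ((⋀[ℂ]^(2 * n) (complexBetti A.X 1)).subtype ((abelianVarietyCohomologyExteriorH1_holds.equiv A (2 * n)).symm cQ))) : ℤ) =
      0 :=
  alternating_sum_choose_row hn _
    (fun _ hk => finrank_S_pureWeilType_minus_all hA hdim hd hφ hP hQ hp hh h11 hvol hcQ hcQ0 hn hk)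

end RealCarrier

end Summit.Ventures.HSemireg.WeilFrame

end
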